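import Literature.NumberTheory.Sieve.HeathBrownSSum
import Mathlib.Analysis.SpecialFunctions.Pow.Real
import Mathlib.Analysis.SpecialFunctions.Log.Base
import Mathlib.Data.Nat.Squarefree

/-!
# Heath-Brown's sum `S(k, t₁, t₂, ρ, σ; q)`: multiplicativity, the reduction (3.5), and Lemma 4

Source: D. R. Heath-Brown, *The divisor function `d₃(n)` in arithmetic progressions*, Acta Arith.
47 (1986), §3, pp. 35–41 [cite: HeathBrown1986d3]. This file continues
`Literature.NumberTheory.Sieve.HeathBrownSSum` (Lemmas 2 and 3) towards Lemma 4: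

`|S(k, t₁, t₂, ρ, σ; q)| ≤ d_A(q) q^{5/2} {(k², (t₁−t₂)², q)(t₁, q)(t₂, q)(ρ, q)(σ, q)}^{1/2} ((t₁−t₂)³, q)^{1/6}`.

## What is formalized

* `SS_mul_of_coprime` — **(3.4)**, twisted multiplicativity of `S` over coprime moduli (in the
  uniformly scaled form delivered by the Chinese remainder theorem).
* `SS_units_scale` — **Lemma 2 for `S`**: `S(k, t₁, t₂, ρ, σ; q) = S((ρσ)⁻¹k, t₁, t₂, 1, 1; q)` for
  units `ρ, σ`.
* `SS_primePow_mul_prime_raw`, `SS_primePow_mul_prime_eq_zero`, `SS_primePow_mul_prime` — **(3.5)**: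
  `S(pk', pt₁, pt₂, pρ, pσ; p^{n+1}) = p⁵ S(k', t₁, t₂, ρ, σ; p^n)` and `= 0` when `p ∤ k` (`n ≥ 1`);
  `SS_primePow_eq_zero_of_mixed` — **(3.3) for `S`**: mixed unit status kills `S`.
* `L4B` — the Lemma-4 majorant (integer parameters), `L4B_ge`, `L4B_step`
  (`p⁵ L4B(p^n; ·) ≤ L4B(p^{n+1}; p·)`), and the bookkeeping `dvd_of_gcd_dvd`, `le_sqrt_G1`,
  `sqrt_le_G2_rpow`.
* `norm_SS_even_units_le`, `norm_SS_odd_units_le` — the unit case from Lemmas 2–3 (with the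
  vanishing clause): `|S(·; p^{2g})| ≤ 12 L4B`, `|S(·; p^{2g+1})| ≤ 96 L4B`.
* **`norm_SS_primePow_le_L4B`** — **Lemma 4 at prime powers modulo Lemma 1**: if
  `|S(·; p)| ≤ C₁ L4B(p; ·)` (HB's Lemma 1, which rests on the Birch–Bombieri bound for the sum `S'`
  of (3.10), a consequence of Deligne's theorem), then `|S(·; p^m)| ≤ max(C₁, 96) L4B(p^m; ·)` for all
  `m ≥ 1`.

* `norm_SS_le_pow_five` (trivial bound), `L4B_one`, `L4B_mul_of_coprime`, `L4B_coprime_scale`,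
  **`norm_SS_le_L4B`** — **Lemma 4 for every `q ≥ 1` modulo Lemma 1**, with the constant
  `max(C₁, 96)^{ω(q)}` (induction over the factorization with (3.4));
  `two_pow_card_primeFactors_le_card_divisors` (`2^{ω(q)} ≤ d(q)`), `pow_card_primeFactors_le`
  (`M^{ω(q)} ≤ d(q)^{log₂ M}`) and **`norm_SS_le_dA_L4B`** — the printed `d_A(q)` form.

Not yet here: Lemma 1 itself (HB pp. 36–37: (3.6)–(3.10) plus the Birch–Bombieri bound
`|S'| ≤ c₁ p^{3/2}`), which discharges the hypothesis `hL1`.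
-/

open Finset

namespace Literature.NumberTheory.Sieve.HeathBrown1986

open Literature.NumberTheory.LFunctions (stdAddChar_eq_mul_of_coprime castHom_inv_of_isUnit
  isUnit_iff_of_coprime sum_zmod_eq_sum_range isUnit_natCast_iff_not_dvd stdAddChar_pow_mul_natCast
  val_inv_natCast_coprime norm_stdAddChar)

/-! ### (3.4): twisted multiplicativity of `S` -/

set_option maxHeartbeats 1600000 in
/-- **(3.4), twisted multiplicativity of `S`**: for `(u, v) = 1`,
`S(k, t₁, t₂, ρ, σ; uv) = S(v̄k, v̄t₁, v̄t₂, v̄ρ, v̄σ; u) · S(ūk, ūt₁, ūt₂, ūρ, ūσ; v)` (reductions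
modulo `u`, `v`; `v̄ v ≡ 1 (mod u)`, `ū u ≡ 1 (mod v)`). HB prints the equivalent form
`S(v²k, t₁, t₂, ρ, σ; u) S(u²k, t₁, t₂, ρ, σ; v)` (substitute `j ↦ v̄³j` and rescale `x, y` in `K₂`);
we keep the uniformly scaled form, which is what the Chinese remainder theorem gives directly and
which has the same gcd invariants. [cite: HeathBrown1986d3, §3 (3.4)] -/
theorem SS_mul_of_coprime {c₁ c₂ : ℕ} [NeZero c₁] [NeZero c₂] [NeZero (c₁ * c₂)]
    (h : c₁.Coprime c₂) (k t₁ t₂ ρ σ : ZMod (c₁ * c₂)) :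
    SS (c₁ * c₂) k t₁ t₂ ρ σ =
      SS c₁ ((c₂ : ZMod c₁)⁻¹ * ZMod.castHom (dvd_mul_right c₁ c₂) (ZMod c₁) k)
          ((c₂ : ZMod c₁)⁻¹ * ZMod.castHom (dvd_mul_right c₁ c₂) (ZMod c₁) t₁)
          ((c₂ : ZMod c₁)⁻¹ * ZMod.castHom (dvd_mul_right c₁ c₂) (ZMod c₁) t₂)
          ((c₂ : ZMod c₁)⁻¹ * ZMod.castHom (dvd_mul_right c₁ c₂) (ZMod c₁) ρ)
          ((c₂ : ZMod c₁)⁻¹ * ZMod.castHom (dvd_mul_right c₁ c₂) (ZMod c₁) σ) *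
        SS c₂ ((c₁ : ZMod c₂)⁻¹ * ZMod.castHom (dvd_mul_left c₂ c₁) (ZMod c₂) k)
          ((c₁ : ZMod c₂)⁻¹ * ZMod.castHom (dvd_mul_left c₂ c₁) (ZMod c₂) t₁)
          ((c₁ : ZMod c₂)⁻¹ * ZMod.castHom (dvd_mul_left c₂ c₁) (ZMod c₂) t₂)
          ((c₁ : ZMod c₂)⁻¹ * ZMod.castHom (dvd_mul_left c₂ c₁) (ZMod c₂) ρ)
          ((c₁ : ZMod c₂)⁻¹ * ZMod.castHom (dvd_mul_left c₂ c₁) (ZMod c₂) σ) := by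
  classical
  set π₁ := ZMod.castHom (dvd_mul_right c₁ c₂) (ZMod c₁) with hπ₁
  set π₂ := ZMod.castHom (dvd_mul_left c₂ c₁) (ZMod c₂) with hπ₂
  set e₂ : ZMod c₁ := (c₂ : ZMod c₁)⁻¹ with he₂
  set e₁ : ZMod c₂ := (c₁ : ZMod c₂)⁻¹ with he₁
  set E := ZMod.chineseRemainder h with hE
  have hE1 : ∀ x, (E x).1 = π₁ x := fun x => Prod.fst_zmod_cast x
  have hE2 : ∀ x, (E x).2 = π₂ x := fun x => Prod.snd_zmod_cast x
  set g₁ : ZMod c₁ → ℂ := fun j₁ => if IsUnit j₁ then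
      (ZMod.stdAddChar (e₂ * π₁ k * j₁) : ℂ) * K2 c₁ (e₂ * π₁ ρ) (e₂ * π₁ σ) (j₁ * (e₂ * π₁ t₁)) *
        starRingEnd ℂ (K2 c₁ (e₂ * π₁ ρ) (e₂ * π₁ σ) (j₁ * (e₂ * π₁ t₂))) else 0 with hg₁
  set g₂ : ZMod c₂ → ℂ := fun j₂ => if IsUnit j₂ then
      (ZMod.stdAddChar (e₁ * π₂ k * j₂) : ℂ) * K2 c₂ (e₁ * π₂ ρ) (e₁ * π₂ σ) (j₂ * (e₁ * π₂ t₁)) *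
        starRingEnd ℂ (K2 c₂ (e₁ * π₂ ρ) (e₁ * π₂ σ) (j₂ * (e₁ * π₂ t₂))) else 0 with hg₂
  have hS : SS (c₁ * c₂) k t₁ t₂ ρ σ = ∑ j : ZMod (c₁ * c₂), g₁ (E j).1 * g₂ (E j).2 := by
    unfold SS
    refine Finset.sum_congr rfl fun j _ => ?_
    rw [hE1, hE2]
    by_cases hj : IsUnit j
    · obtain ⟨hj1, hj2⟩ := (isUnit_iff_of_coprime h j).mp hj
      rw [if_pos hj]
      simp only [hg₁, hg₂]
      rw [if_pos hj1, if_pos hj2, stdAddChar_eq_mul_of_coprime h, K2_mul_of_coprime h,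
        K2_mul_of_coprime h, map_mul (starRingEnd ℂ)]
      simp only [← hπ₁, ← hπ₂, ← he₁, ← he₂]
      have e1 : e₂ * π₁ (k * j) = e₂ * π₁ k * π₁ j := by rw [map_mul]; ring
      have e2 : e₁ * π₂ (k * j) = e₁ * π₂ k * π₂ j := by rw [map_mul]; ring
      have e3 : e₂ * π₁ (j * t₁) = π₁ j * (e₂ * π₁ t₁) := by rw [map_mul]; ring
      have e4 : e₁ * π₂ (j * t₁) = π₂ j * (e₁ * π₂ t₁) := by rw [map_mul]; ring
      have e5 : e₂ * π₁ (j * t₂) = π₁ j * (e₂ * π₁ t₂) := by rw [map_mul]; ring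
      have e6 : e₁ * π₂ (j * t₂) = π₂ j * (e₁ * π₂ t₂) := by rw [map_mul]; ring
      rw [e1, e2, e3, e4, e5, e6]
      ring
    · rw [if_neg hj]
      simp only [hg₁, hg₂]
      by_cases h1 : IsUnit (π₁ j)
      · have h2 : ¬ IsUnit (π₂ j) := fun hx2 => hj ((isUnit_iff_of_coprime h j).mpr ⟨h1, hx2⟩)
        rw [if_neg h2, mul_zero]
      · rw [if_neg h1, zero_mul]
  rw [hS]
  have step : ∑ j : ZMod (c₁ * c₂), g₁ (E j).1 * g₂ (E j).2 =
      ∑ jj : ZMod c₁ × ZMod c₂, g₁ jj.1 * g₂ jj.2 :=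
    Fintype.sum_equiv E.toEquiv (fun j => g₁ (E j).1 * g₂ (E j).2)
      (fun jj : ZMod c₁ × ZMod c₂ => g₁ jj.1 * g₂ jj.2) (fun j => rfl)
  rw [step, Fintype.sum_prod_type, ← Finset.sum_mul_sum]
  rfl

/-! ### Lemma 2 for `S`: scaling out units -/

variable {q : ℕ} [NeZero q]

/-- **Lemma 2 (unit scaling)**: for units `ρ, σ`,
`S(k, t₁, t₂, ρ, σ; q) = S((ρσ)⁻¹ k, t₁, t₂, 1, 1; q)` (`K₂(ρ, σ, c) = K₂(1, 1, ρσc)` and `j ↦ ρσ j`).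
[cite: HeathBrown1986d3, Lemma 2 & p.38] -/
theorem SS_units_scale {ρ σ : ZMod q} (hρ : IsUnit ρ) (hσ : IsUnit σ) (k t₁ t₂ : ZMod q) :
    SS q k t₁ t₂ ρ σ = SS q (k * (ρ * σ)⁻¹) t₁ t₂ 1 1 := by
  classical
  have hu : IsUnit (ρ * σ) := hρ.mul hσ
  obtain ⟨u, hu'⟩ := hu
  have iu : (ρ * σ) * (ρ * σ)⁻¹ = 1 := ZMod.mul_inv_of_unit _ (hu' ▸ Units.isUnit u)
  unfold SS
  conv_rhs => rw [← Equiv.sum_comp (Units.mulLeft u)]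
  refine Finset.sum_congr rfl fun j _ => ?_
  simp only [Units.mulLeft_apply]
  have huj : IsUnit ((u : ZMod q) * j) ↔ IsUnit j :=
    ⟨fun h => by simpa using (Units.isUnit u⁻¹).mul h, fun h => (Units.isUnit u).mul h⟩
  by_cases hj : IsUnit j
  · have a1 : k * (ρ * σ)⁻¹ * ((u : ZMod q) * j) = k * j := by
      rw [hu']; linear_combination (k * j) * iu
    have a2 : (u : ZMod q) * j * t₁ = ρ * σ * (j * t₁) := by rw [hu']; ring
    have a3 : (u : ZMod q) * j * t₂ = ρ * σ * (j * t₂) := by rw [hu']; ring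
    rw [if_pos hj, if_pos (huj.mpr hj), K2_units_scale hρ hσ, K2_units_scale hρ hσ, a1, a2, a3]
  · rw [if_neg hj, if_neg (fun h => hj (huj.mp h))]

/-! ### (3.5): the reduction step at prime powers -/

section PrimePow

variable {p : ℕ} [hp : Fact p.Prime]

set_option maxHeartbeats 1600000 in
/-- **(3.5), one step, raw form**: for `n ≥ 1` and parameters `p t₁, p t₂, p ρ, p σ` modulo `p^{n+1}`,
`S = p⁴ ∑_{u mod p^n}^* K₂'(u t₁') conj K₂'(u t₂') · p·[p ∣ k] · e(ku/p^{n+1})` ((3.2) and the split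
`j = u + p^n v`). [cite: HeathBrown1986d3, §3 (3.5)] -/
theorem SS_primePow_mul_prime_raw {n : ℕ} (hn : n ≠ 0) (k t₁ t₂ ρ σ : ZMod (p ^ (n + 1))) :
    SS (p ^ (n + 1)) k ((p : ZMod (p ^ (n + 1))) * t₁) ((p : ZMod (p ^ (n + 1))) * t₂)
        ((p : ZMod (p ^ (n + 1))) * ρ) ((p : ZMod (p ^ (n + 1))) * σ) =
      (p : ℂ) ^ 4 * ∑ u ∈ range (p ^ n),
        ((if IsUnit ((u : ℕ) : ZMod (p ^ (n + 1))) then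
            K2 (p ^ n) (ZMod.castHom (pow_dvd_pow p (Nat.le_succ n)) (ZMod (p ^ n)) ρ)
              (ZMod.castHom (pow_dvd_pow p (Nat.le_succ n)) (ZMod (p ^ n)) σ)
              (ZMod.castHom (pow_dvd_pow p (Nat.le_succ n)) (ZMod (p ^ n)) ((u : ℕ) : ZMod (p ^ (n + 1))) *
                ZMod.castHom (pow_dvd_pow p (Nat.le_succ n)) (ZMod (p ^ n)) t₁) *
            starRingEnd ℂ (K2 (p ^ n) (ZMod.castHom (pow_dvd_pow p (Nat.le_succ n)) (ZMod (p ^ n)) ρ)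
              (ZMod.castHom (pow_dvd_pow p (Nat.le_succ n)) (ZMod (p ^ n)) σ)
              (ZMod.castHom (pow_dvd_pow p (Nat.le_succ n)) (ZMod (p ^ n)) ((u : ℕ) : ZMod (p ^ (n + 1))) *
                ZMod.castHom (pow_dvd_pow p (Nat.le_succ n)) (ZMod (p ^ n)) t₂)) else 0) *
          (if ZMod.castHom (pow_dvd_pow p (Nat.le_add_left 1 n)) (ZMod (p ^ 1)) k = 0
            then ((p ^ 1 : ℕ) : ℂ) else 0)) *
          (ZMod.stdAddChar (k * ((u : ℕ) : ZMod (p ^ (n + 1)))) : ℂ) := by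
  classical
  have hdvd : p ^ n ∣ p ^ (n + 1) := pow_dvd_pow p (Nat.le_succ n)
  set π := ZMod.castHom hdvd (ZMod (p ^ n)) with hπ
  set ω : ZMod (p ^ (n + 1)) → ℂ := fun j => if IsUnit j then
      K2 (p ^ n) (π ρ) (π σ) (π j * π t₁) * starRingEnd ℂ (K2 (p ^ n) (π ρ) (π σ) (π j * π t₂)) else 0
    with hω
  have hS : SS (p ^ (n + 1)) k ((p : ZMod (p ^ (n + 1))) * t₁) ((p : ZMod (p ^ (n + 1))) * t₂)
      ((p : ZMod (p ^ (n + 1))) * ρ) ((p : ZMod (p ^ (n + 1))) * σ) =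
      (p : ℂ) ^ 4 * ∑ j : ZMod (p ^ (n + 1)), ω j * (ZMod.stdAddChar (k * j) : ℂ) := by
    unfold SS
    rw [Finset.mul_sum]
    refine Finset.sum_congr rfl fun j _ => ?_
    simp only [hω]
    split_ifs with hj
    · rw [show j * ((p : ZMod (p ^ (n + 1))) * t₁) = (p : ZMod (p ^ (n + 1))) * (j * t₁) by ring,
        show j * ((p : ZMod (p ^ (n + 1))) * t₂) = (p : ZMod (p ^ (n + 1))) * (j * t₂) by ring,
        K2_primePow_mul_prime hn, K2_primePow_mul_prime hn, map_mul (starRingEnd ℂ), map_pow,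
        Complex.conj_natCast, map_mul π, map_mul π]
      ring
    · simp
  rw [hS, sum_peel (k := n) (l := 1) (m := n + 1) rfl ω (fun j => k * j) (fun _ => k)]
  · intro x y
    simp only [hω]
    have hu : IsUnit (x + ((p ^ n : ℕ) : ZMod (p ^ (n + 1))) * y) ↔ IsUnit x :=
      isUnit_add_pow_mul_iff hn (by omega) x y
    have hπ0 : π (x + ((p ^ n : ℕ) : ZMod (p ^ (n + 1))) * y) = π x := by
      rw [map_add, castHom_pow_mul le_rfl, add_zero]
    by_cases hx : IsUnit x
    · rw [if_pos (hu.mpr hx), if_pos hx, hπ0]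
    · rw [if_neg (fun h => hx (hu.mp h)), if_neg hx]
  · intro x y; ring

/-- **(3.5), vanishing**: `S(k, p t₁, p t₂, p ρ, p σ; p^{n+1}) = 0` if `p ∤ k` (`n ≥ 1`).
[cite: HeathBrown1986d3, §3 (3.5)] -/
theorem SS_primePow_mul_prime_eq_zero {n : ℕ} (hn : n ≠ 0) (k t₁ t₂ ρ σ : ZMod (p ^ (n + 1)))
    (hk : ZMod.castHom (dvd_pow_self p (by omega : n + 1 ≠ 0)) (ZMod p) k ≠ 0) :
    SS (p ^ (n + 1)) k ((p : ZMod (p ^ (n + 1))) * t₁) ((p : ZMod (p ^ (n + 1))) * t₂)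
        ((p : ZMod (p ^ (n + 1))) * ρ) ((p : ZMod (p ^ (n + 1))) * σ) = 0 := by
  rw [SS_primePow_mul_prime_raw hn]
  have hk' : ZMod.castHom (pow_dvd_pow p (Nat.le_add_left 1 n)) (ZMod (p ^ 1)) k ≠ 0 := by
    intro h0
    apply hk
    have hk1 : k = ((k.val : ℕ) : ZMod (p ^ (n + 1))) := (ZMod.natCast_zmod_val k).symm
    rw [hk1, map_natCast, ZMod.natCast_eq_zero_iff]
    rw [hk1, map_natCast, ZMod.natCast_eq_zero_iff, pow_one] at h0
    exact h0
  simp only [if_neg hk', mul_zero, zero_mul, Finset.sum_const_zero]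

set_option maxHeartbeats 800000 in
/-- **(3.5), reduction**: `S(p k', p t₁, p t₂, p ρ, p σ; p^{n+1}) = p⁵ S(k', t₁, t₂, ρ, σ; p^n)`
(`n ≥ 1`, everything read modulo `p^n` on the right). [cite: HeathBrown1986d3, §3 (3.5)] -/
theorem SS_primePow_mul_prime {n : ℕ} (hn : n ≠ 0) (k' t₁ t₂ ρ σ : ZMod (p ^ (n + 1))) :
    SS (p ^ (n + 1)) ((p : ZMod (p ^ (n + 1))) * k') ((p : ZMod (p ^ (n + 1))) * t₁)
        ((p : ZMod (p ^ (n + 1))) * t₂) ((p : ZMod (p ^ (n + 1))) * ρ) ((p : ZMod (p ^ (n + 1))) * σ) =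
      (p : ℂ) ^ 5 * SS (p ^ n) (ZMod.castHom (pow_dvd_pow p (Nat.le_succ n)) (ZMod (p ^ n)) k')
        (ZMod.castHom (pow_dvd_pow p (Nat.le_succ n)) (ZMod (p ^ n)) t₁)
        (ZMod.castHom (pow_dvd_pow p (Nat.le_succ n)) (ZMod (p ^ n)) t₂)
        (ZMod.castHom (pow_dvd_pow p (Nat.le_succ n)) (ZMod (p ^ n)) ρ)
        (ZMod.castHom (pow_dvd_pow p (Nat.le_succ n)) (ZMod (p ^ n)) σ) := by
  classical
  have hdvd : p ^ n ∣ p ^ (n + 1) := pow_dvd_pow p (Nat.le_succ n)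
  set π := ZMod.castHom hdvd (ZMod (p ^ n)) with hπ
  rw [SS_primePow_mul_prime_raw hn]
  have hk0 : ZMod.castHom (pow_dvd_pow p (Nat.le_add_left 1 n)) (ZMod (p ^ 1)) ((p : ZMod (p ^ (n + 1))) * k') = 0 := by
    rw [map_mul, map_natCast, (ZMod.natCast_eq_zero_iff p (p ^ 1)).mpr (by rw [pow_one]), zero_mul]
  simp only [if_pos hk0]
  -- `e(p k' u / p^{n+1}) = e(k' u / p^n)`
  have hk1 : k' = ((k'.val : ℕ) : ZMod (p ^ (n + 1))) := (ZMod.natCast_zmod_val k').symm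
  have hψ : ∀ u : ℕ, (ZMod.stdAddChar ((p : ZMod (p ^ (n + 1))) * k' * ((u : ℕ) : ZMod (p ^ (n + 1)))) : ℂ) =
      ZMod.stdAddChar (π k' * ((u : ℕ) : ZMod (p ^ n))) := by
    intro u
    rw [hk1, show (p : ZMod (p ^ (n + 1))) * ((k'.val : ℕ) : ZMod (p ^ (n + 1))) * ((u : ℕ) : ZMod (p ^ (n + 1)))
      = ((p ^ 1 * (k'.val * u) : ℕ) : ZMod (p ^ (n + 1))) by push_cast; ring,
      stdAddChar_pow_mul_natCast (k := 1) (l := n) (m := n + 1) (by ring), map_natCast π]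
    simp only [Nat.cast_mul]
  have hunit : ∀ u : ℕ, IsUnit ((u : ℕ) : ZMod (p ^ (n + 1))) ↔ IsUnit ((u : ℕ) : ZMod (p ^ n)) := by
    intro u
    rw [isUnit_natCast_iff_not_dvd (by omega), isUnit_natCast_iff_not_dvd hn]
  unfold SS
  rw [sum_zmod_eq_sum_range, Finset.mul_sum, Finset.mul_sum]
  refine Finset.sum_congr rfl fun u _ => ?_
  rw [hψ u]
  by_cases hu : IsUnit ((u : ℕ) : ZMod (p ^ n))
  · rw [if_pos ((hunit u).mpr hu), if_pos hu, map_natCast]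
    push_cast
    ring
  · rw [if_neg (fun h => hu ((hunit u).mp h)), if_neg hu]
    simp

/-- For a unit `j`, `j t` is a unit iff `t` is. [folklore] -/
theorem isUnit_mul_iff_of_isUnit {R : Type*} [CommMonoid R] {j : R} (hj : IsUnit j) (t : R) :
    IsUnit (j * t) ↔ IsUnit t :=
  ⟨fun h => isUnit_of_mul_isUnit_right h, fun h => hj.mul h⟩

/-- **(3.3) for `S`: mixed unit status kills `S`** (`m ≥ 2`): `S(k, t₁, t₂, ρ, σ; p^m) = 0` unless
`ρ, σ, t₁, t₂` are all units or all non-units modulo `p`. [cite: HeathBrown1986d3, §3 (3.3) & (3.5)] -/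
theorem SS_primePow_eq_zero_of_mixed {m : ℕ} (hm : 2 ≤ m) (k t₁ t₂ ρ σ : ZMod (p ^ m))
    (h : ¬ ((IsUnit ρ ↔ IsUnit t₁) ∧ (IsUnit σ ↔ IsUnit t₁) ∧ (IsUnit ρ ↔ IsUnit t₂) ∧
      (IsUnit σ ↔ IsUnit t₂))) :
    SS (p ^ m) k t₁ t₂ ρ σ = 0 := by
  classical
  haveI : NeZero (p ^ m) := ⟨pow_ne_zero _ hp.out.ne_zero⟩
  have key : ∀ (t j : ZMod (p ^ m)), IsUnit j →
      ¬ ((IsUnit ρ ↔ IsUnit t) ∧ (IsUnit σ ↔ IsUnit t)) → K2 (p ^ m) ρ σ (j * t) = 0 := by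
    intro t j hj hne
    apply K2_primePow_eq_zero_of_degenerate hm
    rw [isUnit_mul_iff_of_isUnit hj]
    tauto
  unfold SS
  refine Finset.sum_eq_zero fun j _ => ?_
  split_ifs with hj
  · by_cases h1 : (IsUnit ρ ↔ IsUnit t₁) ∧ (IsUnit σ ↔ IsUnit t₁)
    · have h2 : ¬ ((IsUnit ρ ↔ IsUnit t₂) ∧ (IsUnit σ ↔ IsUnit t₂)) :=
        fun h2 => h ⟨h1.1, h1.2, h2.1, h2.2⟩
      rw [key t₂ j hj h2, map_zero, mul_zero]
    · rw [key t₁ j hj h1, mul_zero, zero_mul]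
  · rfl

end PrimePow

/-! ### Lemma 4: the majorant and its bookkeeping -/

/-- **Heath-Brown's Lemma-4 majorant**
`q^{5/2} {(k², (t₁ − t₂)², q)(t₁, q)(t₂, q)(ρ, q)(σ, q)}^{1/2} ((t₁ − t₂)³, q)^{1/6}`.
[cite: HeathBrown1986d3, Lemma 4] -/
noncomputable def L4B (q : ℕ) (k t₁ t₂ ρ σ : ℤ) : ℝ :=
  (q : ℝ) ^ (5 / 2 : ℝ) *
    Real.sqrt ((Nat.gcd (Nat.gcd (k ^ 2).natAbs ((t₁ - t₂) ^ 2).natAbs) q : ℝ) *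
      ((Nat.gcd t₁.natAbs q : ℝ) * (Nat.gcd t₂.natAbs q) * (Nat.gcd ρ.natAbs q) * (Nat.gcd σ.natAbs q))) *
    ((Nat.gcd ((t₁ - t₂) ^ 3).natAbs q : ℕ) : ℝ) ^ (1 / 6 : ℝ)

/-- Unfolding `L4B`. [cite: HeathBrown1986d3, Lemma 4] -/
theorem L4B_def (q : ℕ) (k t₁ t₂ ρ σ : ℤ) : L4B q k t₁ t₂ ρ σ =
    (q : ℝ) ^ (5 / 2 : ℝ) *
    Real.sqrt ((Nat.gcd (Nat.gcd (k ^ 2).natAbs ((t₁ - t₂) ^ 2).natAbs) q : ℝ) *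
      ((Nat.gcd t₁.natAbs q : ℝ) * (Nat.gcd t₂.natAbs q) * (Nat.gcd ρ.natAbs q) * (Nat.gcd σ.natAbs q))) *
    ((Nat.gcd ((t₁ - t₂) ^ 3).natAbs q : ℕ) : ℝ) ^ (1 / 6 : ℝ) := rfl

/-- `L4B ≥ 0`. [folklore] -/
theorem L4B_nonneg (q : ℕ) (k t₁ t₂ ρ σ : ℤ) : 0 ≤ L4B q k t₁ t₂ ρ σ := by
  unfold L4B; positivity

/-- Dropping the four single gcds: `L4B ≥ q^{5/2} √(k², (t₁−t₂)², q) ((t₁−t₂)³, q)^{1/6}` (`q ≥ 1`).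
[folklore] -/
theorem L4B_ge (q : ℕ) (hq : q ≠ 0) (k t₁ t₂ ρ σ : ℤ) :
    (q : ℝ) ^ (5 / 2 : ℝ) * Real.sqrt (Nat.gcd (Nat.gcd (k ^ 2).natAbs ((t₁ - t₂) ^ 2).natAbs) q : ℝ) *
      ((Nat.gcd ((t₁ - t₂) ^ 3).natAbs q : ℕ) : ℝ) ^ (1 / 6 : ℝ) ≤ L4B q k t₁ t₂ ρ σ := by
  unfold L4B
  have h1 : ∀ n : ℤ, (1 : ℝ) ≤ (Nat.gcd n.natAbs q : ℝ) := fun n => by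
    exact_mod_cast Nat.pos_of_ne_zero (Nat.gcd_ne_zero_right hq)
  gcongr
  calc (Nat.gcd (Nat.gcd (k ^ 2).natAbs ((t₁ - t₂) ^ 2).natAbs) q : ℝ)
      = (Nat.gcd (Nat.gcd (k ^ 2).natAbs ((t₁ - t₂) ^ 2).natAbs) q : ℝ) * (1 * 1 * 1 * 1) := by ring
    _ ≤ _ := by
      gcongr
      · exact h1 t₁
      · exact h1 t₂
      · exact h1 ρ
      · exact h1 σ

section PrimePowL4

variable {p : ℕ} [hp : Fact p.Prime]

omit hp in
/-- `(p^{2g})^{5/2} = (p^g)^5`. [folklore] -/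
theorem rpow_even_five_halves (g : ℕ) : (((p ^ (g + g) : ℕ) : ℝ)) ^ (5 / 2 : ℝ) = ((p : ℝ) ^ g) ^ 5 := by
  have hp0 : (0 : ℝ) ≤ p := Nat.cast_nonneg p
  rw [show ((p ^ (g + g) : ℕ) : ℝ) = (((p : ℝ) ^ g) ^ 2) by push_cast; ring,
    show (((p : ℝ) ^ g) ^ 2) = ((p : ℝ) ^ g) ^ ((2 : ℕ) : ℝ) by rw [Real.rpow_natCast],
    ← Real.rpow_mul (by positivity), show ((2 : ℕ) : ℝ) * (5 / 2 : ℝ) = ((5 : ℕ) : ℝ) by norm_num,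
    Real.rpow_natCast]

/-- `(p^{2g+1})^{5/2} = (p^g)^5 · p² √p`. [folklore] -/
theorem rpow_odd_five_halves (g : ℕ) :
    (((p ^ (2 * g + 1) : ℕ) : ℝ)) ^ (5 / 2 : ℝ) = ((p : ℝ) ^ g) ^ 5 * ((p : ℝ) ^ 2 * Real.sqrt p) := by
  have hp0 : (0 : ℝ) < p := by exact_mod_cast hp.out.pos
  rw [show ((p ^ (2 * g + 1) : ℕ) : ℝ) = (((p : ℝ) ^ g) ^ 2) * p by push_cast; ring,
    Real.mul_rpow (by positivity) hp0.le,
    show (((p : ℝ) ^ g) ^ 2) = ((p : ℝ) ^ g) ^ ((2 : ℕ) : ℝ) by rw [Real.rpow_natCast],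
    ← Real.rpow_mul (by positivity)]
  rw [show ((2 : ℕ) : ℝ) * (5 / 2 : ℝ) = ((5 : ℕ) : ℝ) by norm_num, Real.rpow_natCast,
    show (5 / 2 : ℝ) = ((2 : ℕ) : ℝ) + 1 / 2 by norm_num, Real.rpow_add hp0, Real.rpow_natCast,
    ← Real.sqrt_eq_rpow]

/-- **The divisibilities at a non-vanishing critical configuration**: with `k̃ = k (ρσ)⁻¹ (mod p^m)`
and `d = (k̃ mod p^g, p^g)`, if `d ∣ (t₂ − t₁ mod p^g)` then `d ∣ k`, `d ∣ t₁ − t₂` and `d ∣ p^g`.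
[cite: HeathBrown1986d3, Lemma 3 & Lemma 4] -/
theorem dvd_of_gcd_dvd {m g : ℕ} (hgm : p ^ g ∣ p ^ m) (k t₁ t₂ : ℤ) {w : ZMod (p ^ m)} (hw : IsUnit w)
    (hd : Nat.gcd (ZMod.castHom hgm (ZMod (p ^ g)) ((k : ZMod (p ^ m)) * w)).val (p ^ g) ∣
      (ZMod.castHom hgm (ZMod (p ^ g)) (t₂ : ZMod (p ^ m)) -
        ZMod.castHom hgm (ZMod (p ^ g)) (t₁ : ZMod (p ^ m))).val) :
    ((Nat.gcd (ZMod.castHom hgm (ZMod (p ^ g)) ((k : ZMod (p ^ m)) * w)).val (p ^ g) : ℕ) : ℤ) ∣ k ∧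
    ((Nat.gcd (ZMod.castHom hgm (ZMod (p ^ g)) ((k : ZMod (p ^ m)) * w)).val (p ^ g) : ℕ) : ℤ) ∣ t₁ - t₂ := by
  set πg := ZMod.castHom hgm (ZMod (p ^ g)) with hπg
  set d := Nat.gcd (πg ((k : ZMod (p ^ m)) * w)).val (p ^ g) with hd_def
  have hdg : d ∣ p ^ g := Nat.gcd_dvd_right _ _
  have hdm : d ∣ p ^ m := hdg.trans hgm
  set τ := ZMod.castHom hdm (ZMod d) with hτ
  set τ' := ZMod.castHom hdg (ZMod d) with hτ'
  have hττ : ∀ x : ZMod (p ^ m), τ x = τ' (πg x) := fun x =>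
    RingHom.congr_fun (Subsingleton.elim τ (τ'.comp πg)) x
  have hzero : ∀ x : ZMod (p ^ m), d ∣ (πg x).val → τ x = 0 := by
    intro x hx
    rw [hττ, hτ', ZMod.castHom_apply, ZMod.cast_eq_val, ZMod.natCast_eq_zero_iff]
    exact hx
  have hk0 : τ ((k : ZMod (p ^ m)) * w) = 0 := hzero _ (Nat.gcd_dvd_left _ _)
  rw [map_mul] at hk0
  have hwu : IsUnit (τ w) := hw.map τ
  have hk1 : τ (k : ZMod (p ^ m)) = 0 := by
    have := congrArg (· * (hwu.unit⁻¹ : (ZMod d)ˣ).val) hk0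
    simpa [mul_assoc, IsUnit.mul_val_inv] using this
  have ht0 : τ ((t₂ : ZMod (p ^ m)) - (t₁ : ZMod (p ^ m))) = 0 := by
    refine hzero _ ?_
    rw [map_sub]
    exact hd
  rw [map_intCast, ZMod.intCast_zmod_eq_zero_iff_dvd] at hk1
  rw [map_sub, map_intCast, map_intCast, ← Int.cast_sub, ZMod.intCast_zmod_eq_zero_iff_dvd] at ht0
  exact ⟨hk1, (dvd_sub_comm.mp ht0)⟩

omit hp in
/-- `d² ∣ (k², (t₁−t₂)², p^m)` from `d ∣ k`, `d ∣ t₁ − t₂`, `d ∣ p^g`, `2g ≤ m`. [folklore] -/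
theorem sq_dvd_G1 {m g d : ℕ} (h2g : g + g ≤ m) (k t₁ t₂ : ℤ) (hk : (d : ℤ) ∣ k) (ht : (d : ℤ) ∣ t₁ - t₂)
    (hd : d ∣ p ^ g) :
    d ^ 2 ∣ Nat.gcd (Nat.gcd (k ^ 2).natAbs ((t₁ - t₂) ^ 2).natAbs) (p ^ m) := by
  refine Nat.dvd_gcd (Nat.dvd_gcd ?_ ?_) ?_
  · rw [Int.natAbs_pow]; exact pow_dvd_pow_of_dvd (Int.natCast_dvd.mp hk) 2
  · rw [Int.natAbs_pow]; exact pow_dvd_pow_of_dvd (Int.natCast_dvd.mp ht) 2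
  · calc d ^ 2 ∣ (p ^ g) ^ 2 := pow_dvd_pow_of_dvd hd 2
      _ = p ^ (g + g) := by ring
      _ ∣ p ^ m := pow_dvd_pow p h2g

/-- Hence `d ≤ √(k², (t₁−t₂)², p^m)`. [folklore] -/
theorem le_sqrt_G1 {m g d : ℕ} (h2g : g + g ≤ m) (k t₁ t₂ : ℤ) (hk : (d : ℤ) ∣ k) (ht : (d : ℤ) ∣ t₁ - t₂)
    (hd : d ∣ p ^ g) :
    (d : ℝ) ≤ Real.sqrt (Nat.gcd (Nat.gcd (k ^ 2).natAbs ((t₁ - t₂) ^ 2).natAbs) (p ^ m) : ℝ) := by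
  have hG : Nat.gcd (Nat.gcd (k ^ 2).natAbs ((t₁ - t₂) ^ 2).natAbs) (p ^ m) ≠ 0 :=
    Nat.gcd_ne_zero_right (pow_ne_zero _ hp.out.ne_zero)
  have hle := Nat.le_of_dvd (Nat.pos_of_ne_zero hG) (sq_dvd_G1 h2g k t₁ t₂ hk ht hd)
  rw [Real.le_sqrt (Nat.cast_nonneg d) (Nat.cast_nonneg _)]
  exact_mod_cast hle

/-- `√p ≤ ((t₁−t₂)³, p^m)^{1/6}` when `p ∣ t₁ − t₂` and `m ≥ 3`. [folklore] -/
theorem sqrt_le_G2_rpow {m : ℕ} (hm : 3 ≤ m) (t₁ t₂ : ℤ) (ht : (p : ℤ) ∣ t₁ - t₂) :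
    Real.sqrt p ≤ ((Nat.gcd ((t₁ - t₂) ^ 3).natAbs (p ^ m) : ℕ) : ℝ) ^ (1 / 6 : ℝ) := by
  have hG : Nat.gcd ((t₁ - t₂) ^ 3).natAbs (p ^ m) ≠ 0 := Nat.gcd_ne_zero_right (pow_ne_zero _ hp.out.ne_zero)
  have hdvd : p ^ 3 ∣ Nat.gcd ((t₁ - t₂) ^ 3).natAbs (p ^ m) := by
    refine Nat.dvd_gcd ?_ (pow_dvd_pow p hm)
    rw [Int.natAbs_pow]; exact pow_dvd_pow_of_dvd (Int.natCast_dvd.mp ht) 3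
  have hle : ((p : ℝ) ^ 3) ≤ (Nat.gcd ((t₁ - t₂) ^ 3).natAbs (p ^ m) : ℕ) := by
    exact_mod_cast Nat.le_of_dvd (Nat.pos_of_ne_zero hG) hdvd
  have hp0 : (0 : ℝ) ≤ p := Nat.cast_nonneg p
  calc Real.sqrt p = (((p : ℝ) ^ 3)) ^ (1 / 6 : ℝ) := by
        rw [Real.sqrt_eq_rpow, show ((p : ℝ) ^ 3) = (p : ℝ) ^ ((3 : ℕ) : ℝ) by rw [Real.rpow_natCast],
          ← Real.rpow_mul hp0]
        norm_num
    _ ≤ _ := Real.rpow_le_rpow (by positivity) hle (by norm_num)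

omit hp in
/-- `1 ≤ ((t₁−t₂)³, q)^{1/6}` for `q ≠ 0`. [folklore] -/
theorem one_le_G2_rpow {q : ℕ} (hq : q ≠ 0) (t₁ t₂ : ℤ) :
    (1 : ℝ) ≤ ((Nat.gcd ((t₁ - t₂) ^ 3).natAbs q : ℕ) : ℝ) ^ (1 / 6 : ℝ) :=
  Real.one_le_rpow (by exact_mod_cast Nat.pos_of_ne_zero (Nat.gcd_ne_zero_right hq)) (by norm_num)

/-- The inverse of a unit of `ZMod q` is a unit. [folklore] -/
theorem isUnit_inv_of_isUnit {q : ℕ} {x : ZMod q} (hx : IsUnit x) : IsUnit x⁻¹ :=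
  IsUnit.of_mul_eq_one x (by rw [mul_comm]; exact ZMod.mul_inv_of_unit x hx)

set_option maxHeartbeats 800000 in
/-- **Unit case, even exponent**: for `g ≥ 1` and `ρ, σ, t₁` units modulo `p`,
`|S(k, t₁, t₂, ρ, σ; p^{2g})| ≤ 12 · L4B`. [cite: HeathBrown1986d3, Lemmas 2–4] -/
theorem norm_SS_even_units_le {g : ℕ} (hg : 1 ≤ g) (k t₁ t₂ ρ σ : ℤ)
    (hρ : IsUnit (ρ : ZMod (p ^ (g + g)))) (hσ : IsUnit (σ : ZMod (p ^ (g + g))))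
    (ht₁ : IsUnit (t₁ : ZMod (p ^ (g + g)))) :
    ‖SS (p ^ (g + g)) k t₁ t₂ ρ σ‖ ≤ 12 * L4B (p ^ (g + g)) k t₁ t₂ ρ σ := by
  have hgm : p ^ g ∣ p ^ (g + g) := pow_dvd_pow p (Nat.le_add_left g g)
  have hq0 : p ^ (g + g) ≠ 0 := pow_ne_zero _ hp.out.ne_zero
  set w : ZMod (p ^ (g + g)) := ((ρ : ZMod (p ^ (g + g))) * (σ : ZMod (p ^ (g + g))))⁻¹ with hw_def
  have hw : IsUnit w := isUnit_inv_of_isUnit (hρ.mul hσ)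
  rw [SS_units_scale hρ hσ]
  set πg := ZMod.castHom hgm (ZMod (p ^ g)) with hπg
  set d := Nat.gcd (πg ((k : ZMod (p ^ (g + g))) * w)).val (p ^ g) with hd_def
  by_cases hd : d ∣ (πg (t₂ : ZMod (p ^ (g + g))) - πg (t₁ : ZMod (p ^ (g + g)))).val
  · obtain ⟨hk, ht⟩ := dvd_of_gcd_dvd hgm k t₁ t₂ hw hd
    have hdg : d ∣ p ^ g := Nat.gcd_dvd_right _ _
    refine (norm_SS_even_le_gcd hg _ _ _ ht₁).trans ?_
    refine le_trans ?_ (mul_le_mul_of_nonneg_left (L4B_ge _ hq0 k t₁ t₂ ρ σ) (by norm_num))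
    rw [rpow_even_five_halves]
    have h1 := le_sqrt_G1 (m := g + g) le_rfl k t₁ t₂ hk ht hdg
    have h2 := one_le_G2_rpow hq0 t₁ t₂
    have hp0 : (0 : ℝ) ≤ p := Nat.cast_nonneg p
    calc 12 * ((p : ℝ) ^ g) ^ 5 * (d : ℝ) = 12 * (((p : ℝ) ^ g) ^ 5 * d * 1) := by ring
      _ ≤ 12 * (((p : ℝ) ^ g) ^ 5 *
          Real.sqrt (Nat.gcd (Nat.gcd (k ^ 2).natAbs ((t₁ - t₂) ^ 2).natAbs) (p ^ (g + g)) : ℝ) *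
          ((Nat.gcd ((t₁ - t₂) ^ 3).natAbs (p ^ (g + g)) : ℕ) : ℝ) ^ (1 / 6 : ℝ)) := by gcongr
  · rw [SS_even_eq_zero_of_not_dvd hg _ _ _ ht₁ hd, norm_zero]
    exact mul_nonneg (by norm_num) (L4B_nonneg _ _ _ _ _ _)

set_option maxHeartbeats 1600000 in
/-- **Unit case, odd exponent**: for `g ≥ 1` and `ρ, σ, t₁` units modulo `p`,
`|S(k, t₁, t₂, ρ, σ; p^{2g+1})| ≤ 96 · L4B` (the constant covers `12√3` from `(3, p)` at `p = 3`
and `12 · 2^{5/2}` from the trivial inner bound at `p = 2`). [cite: HeathBrown1986d3, Lemmas 2–4] -/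
theorem norm_SS_odd_units_le {g : ℕ} (hg : 1 ≤ g) (k t₁ t₂ ρ σ : ℤ)
    (hρ : IsUnit (ρ : ZMod (p ^ (2 * g + 1)))) (hσ : IsUnit (σ : ZMod (p ^ (2 * g + 1))))
    (ht₁ : IsUnit (t₁ : ZMod (p ^ (2 * g + 1)))) :
    ‖SS (p ^ (2 * g + 1)) k t₁ t₂ ρ σ‖ ≤ 96 * L4B (p ^ (2 * g + 1)) k t₁ t₂ ρ σ := by
  have hgm : p ^ g ∣ p ^ (2 * g + 1) := pow_dvd_pow p (by omega : g ≤ 2 * g + 1)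
  have hq0 : p ^ (2 * g + 1) ≠ 0 := pow_ne_zero _ hp.out.ne_zero
  have hp0 : (0 : ℝ) ≤ p := Nat.cast_nonneg p
  have hp1 : (1 : ℝ) ≤ p := by exact_mod_cast hp.out.one_lt.le
  set w : ZMod (p ^ (2 * g + 1)) := ((ρ : ZMod (p ^ (2 * g + 1))) * (σ : ZMod (p ^ (2 * g + 1))))⁻¹
    with hw_def
  have hw : IsUnit w := isUnit_inv_of_isUnit (hρ.mul hσ)
  rw [SS_units_scale hρ hσ]
  set πg := ZMod.castHom hgm (ZMod (p ^ g)) with hπg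
  set kk : ZMod (p ^ (2 * g + 1)) := (k : ZMod (p ^ (2 * g + 1))) * w with hkk
  set d := Nat.gcd (πg kk).val (p ^ g) with hd_def
  by_cases hd : d ∣ (πg (t₂ : ZMod (p ^ (2 * g + 1))) - πg (t₁ : ZMod (p ^ (2 * g + 1)))).val
  swap
  · rw [SS_odd_eq_zero_of_not_dvd hg _ _ _ ht₁ hd, norm_zero]
    exact mul_nonneg (by norm_num) (L4B_nonneg _ _ _ _ _ _)
  obtain ⟨hk, ht⟩ := dvd_of_gcd_dvd hgm k t₁ t₂ hw hd
  have hdg : d ∣ p ^ g := Nat.gcd_dvd_right _ _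
  have h1 := le_sqrt_G1 (m := 2 * g + 1) (by omega) k t₁ t₂ hk ht hdg
  have h2 := one_le_G2_rpow hq0 t₁ t₂
  refine le_trans ?_ (mul_le_mul_of_nonneg_left (L4B_ge _ hq0 k t₁ t₂ ρ σ) (by norm_num))
  rw [rpow_odd_five_halves]
  set G₁ := Real.sqrt (Nat.gcd (Nat.gcd (k ^ 2).natAbs ((t₁ - t₂) ^ 2).natAbs) (p ^ (2 * g + 1)) : ℝ) with hG₁
  set G₂ := ((Nat.gcd ((t₁ - t₂) ^ 3).natAbs (p ^ (2 * g + 1)) : ℕ) : ℝ) ^ (1 / 6 : ℝ) with hG₂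
  have hd0 : (0 : ℝ) ≤ d := Nat.cast_nonneg d
  by_cases hp2 : p = 2
  · -- trivial inner bound: `12 · 2⁵ d ≤ 96 · 4√2 · √G₁`
    refine (norm_SS_odd_le_gcd_triv hg kk _ _ ht₁).trans ?_
    have hp2r : (p : ℝ) = 2 := by exact_mod_cast hp2
    have hs2' : (1 : ℝ) ≤ Real.sqrt 2 := by
      rw [← Real.sqrt_one]; exact Real.sqrt_le_sqrt (by norm_num)
    have h1' : (d : ℝ) ≤ G₁ := h1
    rw [hp2r]
    calc 12 * ((2 : ℝ) ^ g) ^ 5 * 2 ^ 5 * (d : ℝ) = 96 * (((2 : ℝ) ^ g) ^ 5 * (2 ^ 2 * 1)) * d * 1 := by ring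
      _ ≤ 96 * (((2 : ℝ) ^ g) ^ 5 * (2 ^ 2 * Real.sqrt 2)) * G₁ * G₂ := by gcongr
      _ = _ := by ring
  · by_cases hpk : p ∣ kk.val
    · -- `(3k̃, p) = p`, `p ∣ d ∣ t₁ − t₂`, so `√p ≤ G₂^{1/6}`
      have hg3 : Nat.gcd (3 * kk.val) p = p := Nat.gcd_eq_right (dvd_mul_of_dvd_right hpk 3)
      have hpd : p ∣ d := by
        refine Nat.dvd_gcd ?_ (dvd_pow_self p (by omega))
        rw [hπg, ZMod.castHom_apply, ZMod.cast_eq_val, ZMod.val_natCast]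
        exact (Nat.dvd_mod_iff (dvd_pow_self p (by omega))).mpr hpk
      have hpt : (p : ℤ) ∣ t₁ - t₂ := (Int.natCast_dvd_natCast.mpr hpd).trans ht
      have h3 := sqrt_le_G2_rpow (m := 2 * g + 1) (by omega) t₁ t₂ hpt
      refine (norm_SS_odd_le_gcd_sqrt hp2 hg kk _ _ ht₁).trans ?_
      rw [hg3]
      calc 12 * ((p : ℝ) ^ g) ^ 5 * ((p : ℝ) ^ 2 * Real.sqrt p * Real.sqrt p) * (d : ℝ)
          = 12 * (((p : ℝ) ^ g) ^ 5 * ((p : ℝ) ^ 2 * Real.sqrt p)) * d * Real.sqrt p := by ring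
        _ ≤ 96 * (((p : ℝ) ^ g) ^ 5 * ((p : ℝ) ^ 2 * Real.sqrt p)) * G₁ * G₂ := by
          gcongr
          norm_num
        _ = _ := by ring
    · -- `(3k̃, p) ∣ 3`, so `√(3k̃, p) ≤ 2`
      have hcop : Nat.Coprime kk.val p := (Nat.coprime_comm.mp ((Nat.Prime.coprime_iff_not_dvd hp.out).mpr hpk))
      have hg3 : Nat.gcd (3 * kk.val) p ≤ 4 := by
        rw [Nat.Coprime.gcd_mul_right_cancel 3 hcop]
        exact (Nat.le_of_dvd (by norm_num) (Nat.gcd_dvd_left 3 p)).trans (by norm_num)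
      have hs : Real.sqrt (Nat.gcd (3 * kk.val) p) ≤ 2 := by
        rw [show (2 : ℝ) = Real.sqrt 4 by rw [show (4 : ℝ) = 2 ^ 2 by norm_num, Real.sqrt_sq (by norm_num)]]
        exact Real.sqrt_le_sqrt (by exact_mod_cast hg3)
      refine (norm_SS_odd_le_gcd_sqrt hp2 hg kk _ _ ht₁).trans ?_
      calc 12 * ((p : ℝ) ^ g) ^ 5 * ((p : ℝ) ^ 2 * Real.sqrt p * Real.sqrt (Nat.gcd (3 * kk.val) p)) * (d : ℝ)
          = 12 * (((p : ℝ) ^ g) ^ 5 * ((p : ℝ) ^ 2 * Real.sqrt p)) * d *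
              (Real.sqrt (Nat.gcd (3 * kk.val) p) * 1) := by ring
        _ ≤ 12 * (((p : ℝ) ^ g) ^ 5 * ((p : ℝ) ^ 2 * Real.sqrt p)) * G₁ * (2 * G₂) := by gcongr
        _ ≤ 96 * (((p : ℝ) ^ g) ^ 5 * ((p : ℝ) ^ 2 * Real.sqrt p)) * G₁ * G₂ := by
          have : 0 ≤ (((p : ℝ) ^ g) ^ 5 * ((p : ℝ) ^ 2 * Real.sqrt p)) * G₁ * G₂ := by positivity
          nlinarith
        _ = _ := by ring

omit hp in
/-- `(p a, p^{n+1}) = p (a, p^n)` on `natAbs`. [folklore] -/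
theorem gcd_pmul_natAbs (n : ℕ) (a : ℤ) :
    Nat.gcd ((p : ℤ) * a).natAbs (p ^ (n + 1)) = p * Nat.gcd a.natAbs (p ^ n) := by
  rw [Int.natAbs_mul, Int.natAbs_natCast, pow_succ', Nat.gcd_mul_left]

omit hp in
/-- `p (c, p^n) ≤ (p^j c, p^{n+1})` for `j ≥ 1`. [folklore] -/
theorem pmul_gcd_le (n j : ℕ) (hj : 1 ≤ j) (hp0 : p ≠ 0) (c : ℕ) :
    p * Nat.gcd c (p ^ n) ≤ Nat.gcd (p ^ j * c) (p ^ (n + 1)) := by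
  refine Nat.le_of_dvd (Nat.pos_of_ne_zero (Nat.gcd_ne_zero_right (pow_ne_zero _ hp0))) ?_
  rw [pow_succ']
  refine Nat.dvd_gcd ?_ (Nat.mul_dvd_mul_left p (Nat.gcd_dvd_right _ _))
  exact Nat.mul_dvd_mul (dvd_pow_self p (by omega)) (Nat.gcd_dvd_left _ _)

/-- **The (3.5) step is compatible with the majorant**:
`p⁵ L4B(p^n; k, t₁, t₂, ρ, σ) ≤ L4B(p^{n+1}; pk, pt₁, pt₂, pρ, pσ)` (in fact with `p^{1/6}` to spare).
[cite: HeathBrown1986d3, Lemma 4] -/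
theorem L4B_step (n : ℕ) (k t₁ t₂ ρ σ : ℤ) :
    (p : ℝ) ^ 5 * L4B (p ^ n) k t₁ t₂ ρ σ ≤
      L4B (p ^ (n + 1)) ((p : ℤ) * k) ((p : ℤ) * t₁) ((p : ℤ) * t₂) ((p : ℤ) * ρ) ((p : ℤ) * σ) := by
  have hp0 : p ≠ 0 := hp.out.ne_zero
  have hpr : (0 : ℝ) < p := by exact_mod_cast hp.out.pos
  have hp1 : (1 : ℝ) ≤ p := by exact_mod_cast hp.out.one_lt.le
  unfold L4B
  -- the pieces
  have e5 : (((p ^ (n + 1) : ℕ) : ℝ)) ^ (5 / 2 : ℝ) = (p : ℝ) ^ (5 / 2 : ℝ) * (((p ^ n : ℕ) : ℝ)) ^ (5 / 2 : ℝ) := by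
    rw [show ((p ^ (n + 1) : ℕ) : ℝ) = (p : ℝ) * ((p ^ n : ℕ) : ℝ) by push_cast; ring,
      Real.mul_rpow hpr.le (by positivity)]
  have hΔ : (p : ℤ) * t₁ - (p : ℤ) * t₂ = (p : ℤ) * (t₁ - t₂) := by ring
  have eG1 : ((p : ℤ) * k) ^ 2 = ((p ^ 2 : ℕ) : ℤ) * k ^ 2 := by push_cast; ring
  have eG1' : ((p : ℤ) * (t₁ - t₂)) ^ 2 = ((p ^ 2 : ℕ) : ℤ) * (t₁ - t₂) ^ 2 := by push_cast; ring
  have eG2 : ((p : ℤ) * (t₁ - t₂)) ^ 3 = ((p ^ 3 : ℕ) : ℤ) * (t₁ - t₂) ^ 3 := by push_cast; ring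
  have hG1 : (p : ℝ) * (Nat.gcd (Nat.gcd (k ^ 2).natAbs ((t₁ - t₂) ^ 2).natAbs) (p ^ n) : ℝ) ≤
      (Nat.gcd (Nat.gcd (((p : ℤ) * k) ^ 2).natAbs (((p : ℤ) * t₁ - (p : ℤ) * t₂) ^ 2).natAbs) (p ^ (n + 1)) : ℝ) := by
    rw [hΔ, eG1, eG1', Int.natAbs_mul, Int.natAbs_mul, Int.natAbs_natCast, Nat.gcd_mul_left]
    exact_mod_cast pmul_gcd_le n 2 (by norm_num) hp0 _
  have hG2 : (p : ℝ) * (Nat.gcd ((t₁ - t₂) ^ 3).natAbs (p ^ n) : ℝ) ≤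
      (Nat.gcd (((p : ℤ) * t₁ - (p : ℤ) * t₂) ^ 3).natAbs (p ^ (n + 1)) : ℝ) := by
    rw [hΔ, eG2, Int.natAbs_mul, Int.natAbs_natCast]
    exact_mod_cast pmul_gcd_le n 3 (by norm_num) hp0 _
  have hG2' : ((Nat.gcd ((t₁ - t₂) ^ 3).natAbs (p ^ n) : ℕ) : ℝ) ^ (1 / 6 : ℝ) ≤
      ((Nat.gcd (((p : ℤ) * t₁ - (p : ℤ) * t₂) ^ 3).natAbs (p ^ (n + 1)) : ℕ) : ℝ) ^ (1 / 6 : ℝ) := by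
    refine Real.rpow_le_rpow (by positivity) (le_trans ?_ hG2) (by norm_num)
    exact le_mul_of_one_le_left (by positivity) hp1
  rw [gcd_pmul_natAbs, gcd_pmul_natAbs, gcd_pmul_natAbs, gcd_pmul_natAbs, e5]
  set A := (((p ^ n : ℕ) : ℝ)) ^ (5 / 2 : ℝ) with hA
  set G₁ := (Nat.gcd (Nat.gcd (k ^ 2).natAbs ((t₁ - t₂) ^ 2).natAbs) (p ^ n) : ℝ) with hG₁
  set G₁' := (Nat.gcd (Nat.gcd (((p : ℤ) * k) ^ 2).natAbs (((p : ℤ) * t₁ - (p : ℤ) * t₂) ^ 2).natAbs)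
    (p ^ (n + 1)) : ℝ) with hG₁'
  set H := ((Nat.gcd ((t₁ - t₂) ^ 3).natAbs (p ^ n) : ℕ) : ℝ) ^ (1 / 6 : ℝ) with hH
  set H' := ((Nat.gcd (((p : ℤ) * t₁ - (p : ℤ) * t₂) ^ 3).natAbs (p ^ (n + 1)) : ℕ) : ℝ) ^ (1 / 6 : ℝ) with hH'
  set T := ((Nat.gcd t₁.natAbs (p ^ n) : ℝ) * (Nat.gcd t₂.natAbs (p ^ n)) * (Nat.gcd ρ.natAbs (p ^ n)) *
    (Nat.gcd σ.natAbs (p ^ n))) with hT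
  have hT0 : 0 ≤ T := by positivity
  have hG0 : 0 ≤ G₁ := by positivity
  have hH0 : 0 ≤ H := by positivity
  -- `√(G₁' · p⁴ T) ≥ √(p G₁ p⁴ T) = p^{5/2} √(G₁ T)`
  have hsq : (p : ℝ) ^ (5 / 2 : ℝ) * Real.sqrt (G₁ * T) ≤
      Real.sqrt (G₁' * (((p * Nat.gcd t₁.natAbs (p ^ n) : ℕ) : ℝ) * ((p * Nat.gcd t₂.natAbs (p ^ n) : ℕ) : ℝ) *
        ((p * Nat.gcd ρ.natAbs (p ^ n) : ℕ) : ℝ) * ((p * Nat.gcd σ.natAbs (p ^ n) : ℕ) : ℝ))) := by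
    have e : (((p * Nat.gcd t₁.natAbs (p ^ n) : ℕ) : ℝ) * ((p * Nat.gcd t₂.natAbs (p ^ n) : ℕ) : ℝ) *
        ((p * Nat.gcd ρ.natAbs (p ^ n) : ℕ) : ℝ) * ((p * Nat.gcd σ.natAbs (p ^ n) : ℕ) : ℝ)) = (p : ℝ) ^ 4 * T := by
      rw [hT]; push_cast; ring
    rw [e]
    have e2 : (p : ℝ) ^ (5 / 2 : ℝ) = Real.sqrt ((p : ℝ) * (p : ℝ) ^ 4) := by
      rw [show (p : ℝ) * (p : ℝ) ^ 4 = (p : ℝ) ^ 5 by ring, Real.sqrt_eq_rpow,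
        show ((p : ℝ) ^ 5) = (p : ℝ) ^ ((5 : ℕ) : ℝ) by rw [Real.rpow_natCast], ← Real.rpow_mul hpr.le]
      norm_num
    rw [e2, ← Real.sqrt_mul (by positivity)]
    refine Real.sqrt_le_sqrt ?_
    calc (p : ℝ) * (p : ℝ) ^ 4 * (G₁ * T) = ((p : ℝ) * G₁) * ((p : ℝ) ^ 4 * T) := by ring
      _ ≤ G₁' * ((p : ℝ) ^ 4 * T) := by gcongr
  calc (p : ℝ) ^ 5 * ((A * Real.sqrt (G₁ * T)) * H)
      = ((p : ℝ) ^ (5 / 2 : ℝ) * A) * ((p : ℝ) ^ (5 / 2 : ℝ) * Real.sqrt (G₁ * T)) * H := by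
        have : (p : ℝ) ^ 5 = (p : ℝ) ^ (5 / 2 : ℝ) * (p : ℝ) ^ (5 / 2 : ℝ) := by
          rw [← Real.rpow_add hpr]; norm_num
        rw [this]; ring
    _ ≤ ((p : ℝ) ^ (5 / 2 : ℝ) * A) * Real.sqrt (G₁' * (((p * Nat.gcd t₁.natAbs (p ^ n) : ℕ) : ℝ) *
        ((p * Nat.gcd t₂.natAbs (p ^ n) : ℕ) : ℝ) * ((p * Nat.gcd ρ.natAbs (p ^ n) : ℕ) : ℝ) *
        ((p * Nat.gcd σ.natAbs (p ^ n) : ℕ) : ℝ))) * H' := by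
        gcongr

omit hp in
/-- Transport of `‖S‖` along an equality of moduli (integer parameters). [folklore] -/
theorem norm_SS_intCast_congr {c c' : ℕ} [NeZero c] [NeZero c'] (h : c = c') (k t₁ t₂ ρ σ : ℤ) :
    ‖SS c k t₁ t₂ ρ σ‖ = ‖SS c' k t₁ t₂ ρ σ‖ := by
  subst h; rfl

set_option maxHeartbeats 1600000 in
/-- **Lemma 4 at prime powers, modulo Lemma 1**: if `|S(·; p)| ≤ C₁ · L4B(p; ·)` for all integer
parameters (HB's Lemma 1, which rests on the Birch–Bombieri bound), then for every `m ≥ 1`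
`|S(k, t₁, t₂, ρ, σ; p^m)| ≤ max(C₁, 96) · L4B(p^m; k, t₁, t₂, ρ, σ)` — by induction on `m`:
units ⇒ Lemmas 2–3, all divisible by `p` ⇒ (3.5) and `m − 1`, mixed ⇒ (3.3).
[cite: HeathBrown1986d3, Lemma 4 (prime powers)] -/
theorem norm_SS_primePow_le_L4B {C₁ : ℝ}
    (hL1 : ∀ k t₁ t₂ ρ σ : ℤ, ‖SS p k t₁ t₂ ρ σ‖ ≤ C₁ * L4B p k t₁ t₂ ρ σ)
    (m : ℕ) (hm : 1 ≤ m) (k t₁ t₂ ρ σ : ℤ) :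
    ‖SS (p ^ m) k t₁ t₂ ρ σ‖ ≤ max C₁ 96 * L4B (p ^ m) k t₁ t₂ ρ σ := by
  induction m using Nat.strong_induction_on generalizing k t₁ t₂ ρ σ with
  | _ m ih =>
  have hp0 : p ≠ 0 := hp.out.ne_zero
  rcases Nat.eq_or_lt_of_le hm with h1 | h2
  · -- `m = 1`: Lemma 1
    subst h1
    rw [norm_SS_intCast_congr (pow_one p), pow_one]
    exact (hL1 k t₁ t₂ ρ σ).trans (mul_le_mul_of_nonneg_right (le_max_left _ _) (L4B_nonneg _ _ _ _ _ _))
  have hm2 : 2 ≤ m := h2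
  have hm0 : m ≠ 0 := by omega
  have hM12 : (12 : ℝ) ≤ max C₁ 96 := le_max_of_le_right (by norm_num)
  have hM96 : (96 : ℝ) ≤ max C₁ 96 := le_max_right _ _
  have hM0 : (0 : ℝ) ≤ max C₁ 96 := le_trans (by norm_num) hM96
  by_cases hall : IsUnit ((ρ : ℤ) : ZMod (p ^ m)) ∧ IsUnit ((σ : ℤ) : ZMod (p ^ m)) ∧
      IsUnit ((t₁ : ℤ) : ZMod (p ^ m)) ∧ IsUnit ((t₂ : ℤ) : ZMod (p ^ m))
  · obtain ⟨hρ, hσ, ht₁, _⟩ := hall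
    rcases m.even_or_odd with ⟨g, hg⟩ | ⟨g, hg⟩
    · subst hg
      have hg1 : 1 ≤ g := by omega
      exact (norm_SS_even_units_le hg1 k t₁ t₂ ρ σ hρ hσ ht₁).trans
        (mul_le_mul_of_nonneg_right hM12 (L4B_nonneg _ _ _ _ _ _))
    · subst hg
      have hg1 : 1 ≤ g := by omega
      exact (norm_SS_odd_units_le hg1 k t₁ t₂ ρ σ hρ hσ ht₁).trans
        (mul_le_mul_of_nonneg_right hM96 (L4B_nonneg _ _ _ _ _ _))
  by_cases hnone : ¬ IsUnit ((ρ : ℤ) : ZMod (p ^ m)) ∧ ¬ IsUnit ((σ : ℤ) : ZMod (p ^ m)) ∧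
      ¬ IsUnit ((t₁ : ℤ) : ZMod (p ^ m)) ∧ ¬ IsUnit ((t₂ : ℤ) : ZMod (p ^ m))
  · -- all divisible by `p`
    obtain ⟨hρ, hσ, ht₁, ht₂⟩ := hnone
    have hdvd : ∀ x : ℤ, ¬ IsUnit ((x : ℤ) : ZMod (p ^ m)) → (p : ℤ) ∣ x := fun x hx => by
      rw [isUnit_intCast_iff hm0, not_not] at hx
      exact Int.natCast_dvd.mpr hx
    obtain ⟨ρ', rfl⟩ := hdvd ρ hρ
    obtain ⟨σ', rfl⟩ := hdvd σ hσ
    obtain ⟨t₁', rfl⟩ := hdvd t₁ ht₁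
    obtain ⟨t₂', rfl⟩ := hdvd t₂ ht₂
    obtain ⟨n, rfl⟩ : ∃ n, m = n + 1 := ⟨m - 1, by omega⟩
    have hn : n ≠ 0 := by omega
    have hcast : ∀ x : ℤ, (((p : ℤ) * x : ℤ) : ZMod (p ^ (n + 1))) =
        (p : ZMod (p ^ (n + 1))) * (x : ZMod (p ^ (n + 1))) := fun x => by push_cast; ring
    by_cases hpk : (p : ℤ) ∣ k
    · obtain ⟨k', rfl⟩ := hpk
      rw [hcast, hcast, hcast, hcast, hcast, SS_primePow_mul_prime hn, norm_mul]
      simp only [map_intCast]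
      have hIH := ih n (by omega) (Nat.one_le_iff_ne_zero.mpr hn) k' t₁' t₂' ρ' σ'
      have hstep := L4B_step (p := p) n k' t₁' t₂' ρ' σ'
      have hn5 : ‖(p : ℂ) ^ 5‖ = (p : ℝ) ^ 5 := by simp
      rw [hn5]
      calc (p : ℝ) ^ 5 * ‖SS (p ^ n) (k' : ZMod (p ^ n)) t₁' t₂' ρ' σ'‖
          ≤ (p : ℝ) ^ 5 * (max C₁ 96 * L4B (p ^ n) k' t₁' t₂' ρ' σ') := by gcongr
        _ = max C₁ 96 * ((p : ℝ) ^ 5 * L4B (p ^ n) k' t₁' t₂' ρ' σ') := by ring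
        _ ≤ max C₁ 96 * L4B (p ^ (n + 1)) ((p : ℤ) * k') ((p : ℤ) * t₁') ((p : ℤ) * t₂') ((p : ℤ) * ρ')
            ((p : ℤ) * σ') := mul_le_mul_of_nonneg_left hstep hM0
    · have hk : ZMod.castHom (dvd_pow_self p (by omega : n + 1 ≠ 0)) (ZMod p) ((k : ℤ) : ZMod (p ^ (n + 1))) ≠ 0 := by
        rw [map_intCast, Ne, ZMod.intCast_zmod_eq_zero_iff_dvd]
        exact hpk
      rw [hcast, hcast, hcast, hcast, SS_primePow_mul_prime_eq_zero hn _ _ _ _ _ hk, norm_zero]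
      exact mul_nonneg hM0 (L4B_nonneg _ _ _ _ _ _)
  · -- mixed status
    rw [SS_primePow_eq_zero_of_mixed hm2 _ _ _ _ _ (by tauto), norm_zero]
    exact mul_nonneg hM0 (L4B_nonneg _ _ _ _ _ _)

end PrimePowL4

/-! ### Lemma 4 for general moduli -/

section General

/-- The trivial bound `|S(·; q)| ≤ q⁵`. [folklore] -/
theorem norm_SS_le_pow_five (q : ℕ) [NeZero q] (k t₁ t₂ ρ σ : ZMod q) : ‖SS q k t₁ t₂ ρ σ‖ ≤ (q : ℝ) ^ 5 := by
  classical
  unfold SS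
  refine (norm_sum_le _ _).trans ?_
  have hq : (0 : ℝ) ≤ q := Nat.cast_nonneg q
  calc ∑ j : ZMod q, ‖(if IsUnit j then (ZMod.stdAddChar (k * j) : ℂ) * K2 q ρ σ (j * t₁) *
        starRingEnd ℂ (K2 q ρ σ (j * t₂)) else 0)‖ ≤ ∑ _j : ZMod q, (q : ℝ) ^ 4 := by
        refine Finset.sum_le_sum fun j _ => ?_
        split_ifs
        · rw [norm_mul, norm_mul, norm_stdAddChar, one_mul, Complex.norm_conj]
          calc ‖K2 q ρ σ (j * t₁)‖ * ‖K2 q ρ σ (j * t₂)‖ ≤ ((q : ℝ) * q) * ((q : ℝ) * q) :=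
                mul_le_mul (norm_K2_le_sq q _ _ _) (norm_K2_le_sq q _ _ _) (norm_nonneg _) (by positivity)
            _ = (q : ℝ) ^ 4 := by ring
        · rw [norm_zero]; positivity
    _ = (q : ℝ) ^ 5 := by rw [Finset.sum_const, Finset.card_univ, ZMod.card, nsmul_eq_mul]; ring

/-- `L4B(1; ·) = 1`. [folklore] -/
theorem L4B_one (k t₁ t₂ ρ σ : ℤ) : L4B 1 k t₁ t₂ ρ σ = 1 := by
  simp [L4B]

/-- `L4B` is multiplicative in `q`. [folklore] -/
theorem L4B_mul_of_coprime {c₁ c₂ : ℕ} (h : c₁.Coprime c₂) (k t₁ t₂ ρ σ : ℤ) :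
    L4B (c₁ * c₂) k t₁ t₂ ρ σ = L4B c₁ k t₁ t₂ ρ σ * L4B c₂ k t₁ t₂ ρ σ := by
  unfold L4B
  rw [Nat.Coprime.gcd_mul _ h, Nat.Coprime.gcd_mul _ h, Nat.Coprime.gcd_mul _ h, Nat.Coprime.gcd_mul _ h,
    Nat.Coprime.gcd_mul _ h, Nat.Coprime.gcd_mul _ h]
  push_cast
  rw [Real.mul_rpow (Nat.cast_nonneg c₁) (Nat.cast_nonneg c₂),
    Real.mul_rpow (Nat.cast_nonneg _) (Nat.cast_nonneg _)]
  rw [show ((Nat.gcd (Nat.gcd (k ^ 2).natAbs ((t₁ - t₂) ^ 2).natAbs) c₁ : ℝ) *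
      (Nat.gcd (Nat.gcd (k ^ 2).natAbs ((t₁ - t₂) ^ 2).natAbs) c₂ : ℝ)) *
      (((Nat.gcd t₁.natAbs c₁ : ℝ) * (Nat.gcd t₁.natAbs c₂ : ℝ)) * ((Nat.gcd t₂.natAbs c₁ : ℝ) *
        (Nat.gcd t₂.natAbs c₂ : ℝ)) * ((Nat.gcd ρ.natAbs c₁ : ℝ) * (Nat.gcd ρ.natAbs c₂ : ℝ)) *
        ((Nat.gcd σ.natAbs c₁ : ℝ) * (Nat.gcd σ.natAbs c₂ : ℝ))) =
      ((Nat.gcd (Nat.gcd (k ^ 2).natAbs ((t₁ - t₂) ^ 2).natAbs) c₁ : ℝ) *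
        ((Nat.gcd t₁.natAbs c₁ : ℝ) * (Nat.gcd t₂.natAbs c₁ : ℝ) * (Nat.gcd ρ.natAbs c₁ : ℝ) *
          (Nat.gcd σ.natAbs c₁ : ℝ))) *
      ((Nat.gcd (Nat.gcd (k ^ 2).natAbs ((t₁ - t₂) ^ 2).natAbs) c₂ : ℝ) *
        ((Nat.gcd t₁.natAbs c₂ : ℝ) * (Nat.gcd t₂.natAbs c₂ : ℝ) * (Nat.gcd ρ.natAbs c₂ : ℝ) *
          (Nat.gcd σ.natAbs c₂ : ℝ))) by ring,
    Real.sqrt_mul (by positivity)]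
  ring

/-- `L4B` is invariant under scaling all parameters by an integer coprime to `q`. [folklore] -/
theorem L4B_coprime_scale {c e : ℕ} (he : e.Coprime c) (k t₁ t₂ ρ σ : ℤ) :
    L4B c ((e : ℤ) * k) ((e : ℤ) * t₁) ((e : ℤ) * t₂) ((e : ℤ) * ρ) ((e : ℤ) * σ) = L4B c k t₁ t₂ ρ σ := by
  unfold L4B
  have h1 : ∀ x : ℤ, Nat.gcd ((e : ℤ) * x).natAbs c = Nat.gcd x.natAbs c := fun x => by
    rw [Int.natAbs_mul, Int.natAbs_natCast, Nat.Coprime.gcd_mul_left_cancel _ he]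
  have hΔ : (e : ℤ) * t₁ - (e : ℤ) * t₂ = (e : ℤ) * (t₁ - t₂) := by ring
  have h2 : Nat.gcd (Nat.gcd (((e : ℤ) * k) ^ 2).natAbs (((e : ℤ) * t₁ - (e : ℤ) * t₂) ^ 2).natAbs) c =
      Nat.gcd (Nat.gcd (k ^ 2).natAbs ((t₁ - t₂) ^ 2).natAbs) c := by
    rw [hΔ, mul_pow, mul_pow, Int.natAbs_mul, Int.natAbs_mul, Int.natAbs_pow, Int.natAbs_natCast,
      Nat.gcd_mul_left, Nat.Coprime.gcd_mul_left_cancel _ (Nat.Coprime.pow_left 2 he)]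
  have h3 : Nat.gcd (((e : ℤ) * t₁ - (e : ℤ) * t₂) ^ 3).natAbs c = Nat.gcd ((t₁ - t₂) ^ 3).natAbs c := by
    rw [hΔ, mul_pow, Int.natAbs_mul, Int.natAbs_pow, Int.natAbs_natCast,
      Nat.Coprime.gcd_mul_left_cancel _ (Nat.Coprime.pow_left 3 he)]
  rw [h1, h1, h1, h1, h2, h3]

set_option maxHeartbeats 1600000 in
/-- **Heath-Brown's Lemma 4, modulo Lemma 1**: if `|S(·; p)| ≤ C₁ L4B(p; ·)` at every prime, then for
every `q ≥ 1` and all integers `k, t₁, t₂, ρ, σ`,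
`|S(k, t₁, t₂, ρ, σ; q)| ≤ max(C₁, 96)^{ω(q)} q^{5/2} {(k², (t₁−t₂)², q)(t₁,q)(t₂,q)(ρ,q)(σ,q)}^{1/2} ((t₁−t₂)³, q)^{1/6}`
(and `max(C₁,96)^{ω(q)} ≤ d(q)^A`, HB's `d_A(q)`). [cite: HeathBrown1986d3, Lemma 4] -/
theorem norm_SS_le_L4B {C₁ : ℝ}
    (hL1 : ∀ (p : ℕ) [Fact p.Prime] (k t₁ t₂ ρ σ : ℤ), ‖SS p k t₁ t₂ ρ σ‖ ≤ C₁ * L4B p k t₁ t₂ ρ σ)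
    (q : ℕ) [NeZero q] (k t₁ t₂ ρ σ : ℤ) :
    ‖SS q k t₁ t₂ ρ σ‖ ≤ max C₁ 96 ^ q.primeFactors.card * L4B q k t₁ t₂ ρ σ := by
  suffices key : ∀ c : ℕ, ∀ hc : c ≠ 0, ∀ k t₁ t₂ ρ σ : ℤ,
      ‖@SS c ⟨hc⟩ (k : ZMod c) (t₁ : ZMod c) (t₂ : ZMod c) (ρ : ZMod c) (σ : ZMod c)‖ ≤
        max C₁ 96 ^ c.primeFactors.card * L4B c k t₁ t₂ ρ σ by
    exact key q (NeZero.ne q) k t₁ t₂ ρ σ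
  have hM0 : (0 : ℝ) ≤ max C₁ 96 := le_trans (by norm_num) (le_max_right _ _)
  intro c
  induction c using Nat.recOnPrimeCoprime with
  | zero => intro hc; exact absurd rfl hc
  | prime_pow p m hpm =>
      intro hc k t₁ t₂ ρ σ
      haveI : NeZero (p ^ m) := ⟨hc⟩
      haveI : Fact p.Prime := ⟨hpm⟩
      rcases Nat.eq_zero_or_pos m with rfl | hm
      · -- `c = 1`
        haveI : NeZero (p ^ 0) := ⟨hc⟩
        rw [norm_SS_intCast_congr (pow_zero p)]
        rw [pow_zero, Nat.primeFactors_one, Finset.card_empty, pow_zero, one_mul, L4B_one]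
        have := norm_SS_le_pow_five 1 ((k : ℤ) : ZMod 1) t₁ t₂ ρ σ
        simpa using this
      · rw [Nat.primeFactors_prime_pow hm.ne' hpm, Finset.card_singleton, pow_one]
        exact norm_SS_primePow_le_L4B (fun k t₁ t₂ ρ σ => hL1 p k t₁ t₂ ρ σ) m hm k t₁ t₂ ρ σ
  | coprime c₁ c₂ hc₁ hc₂ hcop ih₁ ih₂ =>
      intro hc k t₁ t₂ ρ σ
      haveI : NeZero c₁ := ⟨by omega⟩
      haveI : NeZero c₂ := ⟨by omega⟩
      haveI : NeZero (c₁ * c₂) := ⟨hc⟩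
      have hcop₂ : ((c₂ : ZMod c₁)⁻¹).val.Coprime c₁ := val_inv_natCast_coprime hcop
      have hcop₁ : ((c₁ : ZMod c₂)⁻¹).val.Coprime c₂ := val_inv_natCast_coprime hcop.symm
      have hfac := SS_mul_of_coprime hcop (k : ZMod (c₁ * c₂)) (t₁ : ZMod (c₁ * c₂))
        (t₂ : ZMod (c₁ * c₂)) (ρ : ZMod (c₁ * c₂)) (σ : ZMod (c₁ * c₂))
      have hcast₁ : ∀ x : ℤ, (c₂ : ZMod c₁)⁻¹ *
          ZMod.castHom (dvd_mul_right c₁ c₂) (ZMod c₁) (x : ZMod (c₁ * c₂)) =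
            (((((c₂ : ZMod c₁)⁻¹).val : ℤ) * x : ℤ) : ZMod c₁) := by
        intro x; rw [map_intCast]; push_cast; rw [ZMod.natCast_zmod_val]
      have hcast₂ : ∀ x : ℤ, (c₁ : ZMod c₂)⁻¹ *
          ZMod.castHom (dvd_mul_left c₂ c₁) (ZMod c₂) (x : ZMod (c₁ * c₂)) =
            (((((c₁ : ZMod c₂)⁻¹).val : ℤ) * x : ℤ) : ZMod c₂) := by
        intro x; rw [map_intCast]; push_cast; rw [ZMod.natCast_zmod_val]
      rw [hcast₁, hcast₁, hcast₁, hcast₁, hcast₁, hcast₂, hcast₂, hcast₂, hcast₂, hcast₂] at hfac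
      have hb₁ := ih₁ (NeZero.ne c₁) ((((c₂ : ZMod c₁)⁻¹).val : ℤ) * k)
        ((((c₂ : ZMod c₁)⁻¹).val : ℤ) * t₁) ((((c₂ : ZMod c₁)⁻¹).val : ℤ) * t₂)
        ((((c₂ : ZMod c₁)⁻¹).val : ℤ) * ρ) ((((c₂ : ZMod c₁)⁻¹).val : ℤ) * σ)
      have hb₂ := ih₂ (NeZero.ne c₂) ((((c₁ : ZMod c₂)⁻¹).val : ℤ) * k)
        ((((c₁ : ZMod c₂)⁻¹).val : ℤ) * t₁) ((((c₁ : ZMod c₂)⁻¹).val : ℤ) * t₂)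
        ((((c₁ : ZMod c₂)⁻¹).val : ℤ) * ρ) ((((c₁ : ZMod c₂)⁻¹).val : ℤ) * σ)
      rw [L4B_coprime_scale hcop₂] at hb₁
      rw [L4B_coprime_scale hcop₁] at hb₂
      rw [hfac, norm_mul, L4B_mul_of_coprime hcop, Nat.Coprime.primeFactors_mul hcop,
        Finset.card_union_of_disjoint (Nat.Coprime.disjoint_primeFactors hcop), pow_add]
      calc _ ≤ (max C₁ 96 ^ c₁.primeFactors.card * L4B c₁ k t₁ t₂ ρ σ) *
          (max C₁ 96 ^ c₂.primeFactors.card * L4B c₂ k t₁ t₂ ρ σ) :=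
            mul_le_mul hb₁ hb₂ (norm_nonneg _) (mul_nonneg (pow_nonneg hM0 _) (L4B_nonneg _ _ _ _ _ _))
        _ = _ := by ring


/-- `2^{ω(q)} ≤ d(q)`: the square-free divisors `∏_{p ∈ S} p`, `S ⊆ primeFactors q`, are distinct.
[folklore] -/
theorem two_pow_card_primeFactors_le_card_divisors {q : ℕ} (hq : q ≠ 0) :
    2 ^ q.primeFactors.card ≤ (Nat.divisors q).card := by
  classical
  rw [← Finset.card_powerset]
  refine Finset.card_le_card_of_injOn (fun S => ∏ p ∈ S, p) (fun S hS => ?_) ?_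
  · rw [Finset.mem_coe, Finset.mem_powerset] at hS
    rw [Finset.mem_coe, Nat.mem_divisors]
    exact ⟨(Finset.prod_dvd_prod_of_subset _ _ _ hS).trans (Nat.prod_primeFactors_dvd q), hq⟩
  · intro S hS T hT hST
    rw [Finset.mem_coe, Finset.mem_powerset] at hS hT
    have hS' : ∀ p ∈ S, p.Prime := fun p hp => Nat.prime_of_mem_primeFactors (hS hp)
    have hT' : ∀ p ∈ T, p.Prime := fun p hp => Nat.prime_of_mem_primeFactors (hT hp)
    have := congrArg Nat.primeFactors hST
    simp only at this
    rwa [Nat.primeFactors_prod hS', Nat.primeFactors_prod hT'] at this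

/-- **`M^{ω(q)} ≤ d(q)^A`** with `A = log₂ M` (`M ≥ 1`): HB's `d_A(q)`. [cite: HeathBrown1986d3, §2 Notation] -/
theorem pow_card_primeFactors_le {q : ℕ} (hq : q ≠ 0) {M : ℝ} (hM : 1 ≤ M) :
    M ^ q.primeFactors.card ≤ ((Nat.divisors q).card : ℝ) ^ (Real.logb 2 M) := by
  have hM0 : 0 < M := by linarith
  have hA : 0 ≤ Real.logb 2 M := Real.logb_nonneg (by norm_num) hM
  have h2 := two_pow_card_primeFactors_le_card_divisors hq
  calc M ^ q.primeFactors.card = ((2 : ℝ) ^ Real.logb 2 M) ^ q.primeFactors.card := by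
        rw [Real.rpow_logb (by norm_num) (by norm_num) hM0]
    _ = ((2 : ℝ) ^ q.primeFactors.card) ^ Real.logb 2 M := by
        rw [← Real.rpow_natCast, ← Real.rpow_mul (by norm_num), mul_comm, Real.rpow_mul (by norm_num),
          Real.rpow_natCast]
    _ ≤ ((Nat.divisors q).card : ℝ) ^ Real.logb 2 M := by
        refine Real.rpow_le_rpow (by positivity) ?_ hA
        exact_mod_cast h2

/-- **Heath-Brown's Lemma 4 in the printed `d_A(q)` form (modulo Lemma 1).**
[cite: HeathBrown1986d3, Lemma 4] -/
theorem norm_SS_le_dA_L4B {C₁ : ℝ}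
    (hL1 : ∀ (p : ℕ) [Fact p.Prime] (k t₁ t₂ ρ σ : ℤ), ‖SS p k t₁ t₂ ρ σ‖ ≤ C₁ * L4B p k t₁ t₂ ρ σ)
    (q : ℕ) [NeZero q] (k t₁ t₂ ρ σ : ℤ) :
    ‖SS q k t₁ t₂ ρ σ‖ ≤ ((Nat.divisors q).card : ℝ) ^ (Real.logb 2 (max C₁ 96)) * L4B q k t₁ t₂ ρ σ :=
  (norm_SS_le_L4B hL1 q k t₁ t₂ ρ σ).trans (mul_le_mul_of_nonneg_right
    (pow_card_primeFactors_le (NeZero.ne q) (le_trans (by norm_num) (le_max_right _ _))) (L4B_nonneg _ _ _ _ _ _))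

end General

end Literature.NumberTheory.Sieve.HeathBrown1986
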